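import Summits.QuantumFields.YangMills.Theorems.BalabanUVNodesN07PlateCaccioppoli
import HarnessLib

/-!
# DAG node N07 — the ONE-STEP INTERIOR PLATE-ENERGY ESTIMATE for discrete BIHARMONIC functions on the torus (CORE file)
# (hole-filling form `E(inner) ≤ ½·E(outer) + K(d)·δ⁴·Σ_outer h²`), geometry carried as hypotheses: road item (L2) ∕ socket (S3)

Width seat `pub-ymgap-dag-n07-w7` (g6), count-neutral helper (`--supports … --as helper`); sequel of this seat's
`…Theorems.BalabanUVNodesN07PlateCaccioppoli` (p635306: `plate_caccioppoli_core`, `neg_sum_lap_mul_mul_le`,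
`dirichlet_interpolation`) on g3's calculus (`fd`, `bd`, `lap` on `TorusSite d N`).

WHAT.  For `h` with `Δ²h = 0` wherever a cut-off `χ` lives, `|∂χ| ≤ δ`, `|∂∂χ| ≤ δ²`, and a second cut-off `ψ ∈ [0,1]` with
`|∂ψ| ≤ δ`, equal to `1` on the radius-2 neighbourhood of the set where `χ` varies, and supported together with its
1-neighbourhood in a finset `M`:
  ★★★ `biharmonic_plate_step`:  `Σ_x χ(x)²(Δh(x))² ≤ ½·Σ_{x∈M} (Δh(x))² + 8464·d²·δ⁴·Σ_{x∈M} h(x)²`.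
This is the hypothesis of the hole-filling ∕ Giaquinta iteration (θ = ½, exponent 4; the tree's
`Literature.Analysis.PDE.GiaquintaIterationLemma.lemma_V_3_1`), which turns it into the interior estimate
`Σ_{B_ρ}(Δh)² ≤ C(d)(r−ρ)⁻⁴Σ_{B_r}h²` once box cut-offs on `TorusSite` with the stated bounds are supplied (NOT in this file:
no geometry is constructed here — every geometric fact enters as a hypothesis on `χ`, `ψ`, `M`).
* §1 the SCALE-CORRECT transport bound: `transport_eq_grad_form` (`K_χu(x) = Σᵢ[∂ᵢχ(x)(∂ᵢu(x)+∂ᵢu(x−eᵢ)) + ∂ᵢ∂ᵢχ(x−eᵢ)·u(x−eᵢ)]`),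
  `transport_sq_le_grad` (`(K_χu)² ≤ 3d·Σᵢ[(∂ᵢχ)²(∂ᵢu)² + (∂ᵢχ)²(∂ᵢu(·−eᵢ))² + (∂ᵢ∂ᵢχ(·−eᵢ))²u(·−eᵢ)²]`, replacing p635306's
  `transport_sq_le` whose `(∂χ)²u²` weight is off by `δ⁻²` in scale);
* §2 pointwise domination tools (`sq_mul_le_of_dom`, `abs_sq_sub_sq_le`, `mul_abs_mul_abs_le`, `sum_sq_mul_le_sum_mem`);
* §3 `transport_sum_le`, `weight_fwd_le` ∕ `weight_bwd_le` (the two error terms of p635306's `plate_caccioppoli_core`, dominated),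
  ★★ `plate_energy_le_of_biharmonic` (`Σχ²(Δh)² ≤ 32d·δ²·D_ψ + 16d²·δ⁴·H_ψ` with the ψ-dominated gradient ∕ mass sums
  `D_ψ = ΣⱼΣ_x(ψ(x)²+ψ(x+eⱼ)²)(∂ⱼh(x))²`, `H_ψ = Σ_x ψ(x)²h(x)²`), ★★★ `biharmonic_plate_step`.

HONEST SCOPE.  Finite-difference algebra, Young and Cauchy–Schwarz on one torus; asserts NOTHING about [B11]∕[B6]∕[3]; the box
cut-offs, the iteration, the orders 1 and 3, the robust one-level inequality in x-space and the assembly (S4)–(S5) of the road are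
NOT here; (P)_D for Bałaban's `d = 4` geometries OPEN; `hker` at the record, stub 1, K0⁷ ∕ K1⁹ NOT closed; N07 not discharged;
nothing continuum ∕ OS ∕ mass gap.  Context only (no hypothesis is a citation): M. Giaquinta, *Multiple integrals in the calculus
of variations and nonlinear elliptic systems* (1983) Ch. III §2, Ch. V Lemma 3.1 [Giaquinta1984]; T. Bałaban, CMP **96** (1984)
223–250 [Balaban1984PropagatorsII] (1.9), (2.22).

FILE SPLIT (400-line cap): this CORE file holds §1, §2 and the first half of §3 (`transport_sum_le`, `weight_fwd_le`);
the sequel `…N07PlateCaccioppoliBiharmonic` holds `weight_bwd_le`, ★★ `plate_energy_le_of_biharmonic`, ★★★ `biharmonic_plate_step`.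
-/

set_option autoImplicit false

noncomputable section

open Finset

namespace Summit.QuantumFields.YangMills.Theorems.N07PlateCaccioppoliBiharmonic

open Literature.Probability.LatticeModels (TorusSite)
open Summit.QuantumFields.YangMills.Theorems.N07PointFeasibilityEnergyIdentity (fd bd lap sum_shift sum_shift_sub
  bd_eq_fd_sub)
open Summit.QuantumFields.YangMills.Theorems.N07PlateCaccioppoli (plate_caccioppoli_core neg_sum_lap_mul_mul_le
  dirichlet_interpolation)

variable {d N : ℕ}

/-! ## §1  The scale-correct transport bound -/

section Transport

variable {𝕜 : Type*} [CommRing 𝕜]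

/-- The transport term in gradient form:
`K_χu(x) = Σᵢ [∂ᵢχ(x)·(∂ᵢu(x) + ∂ᵢu(x−eᵢ)) + ∂ᵢ∂ᵢχ(x−eᵢ)·u(x−eᵢ)]` (`≈ 2∇χ·∇u + (Δχ)u`). [folklore] -/
theorem transport_eq_grad_form (χ u : TorusSite d N → 𝕜) (x : TorusSite d N) :
    ∑ i, ((χ (x + Pi.single i 1) - χ x) * u (x + Pi.single i 1) +
        (χ (x - Pi.single i 1) - χ x) * u (x - Pi.single i 1)) =
      ∑ i, (fd i χ x * (fd i u x + fd i u (x - Pi.single i 1)) +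
        fd i (fd i χ) (x - Pi.single i 1) * u (x - Pi.single i 1)) := by
  refine Finset.sum_congr rfl (fun i _ => ?_)
  simp only [fd, sub_add_cancel]
  ring

end Transport

section Real

/-- ★ **Scale-correct transport bound**:
`(K_χu(x))² ≤ 3d·Σᵢ [(∂ᵢχ(x))²(∂ᵢu(x))² + (∂ᵢχ(x))²(∂ᵢu(x−eᵢ))² + (∂ᵢ∂ᵢχ(x−eᵢ))²u(x−eᵢ)²]`. [folklore] -/
theorem transport_sq_le_grad (χ u : TorusSite d N → ℝ) (x : TorusSite d N) :
    (∑ i, ((χ (x + Pi.single i 1) - χ x) * u (x + Pi.single i 1) +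
        (χ (x - Pi.single i 1) - χ x) * u (x - Pi.single i 1))) ^ 2 ≤
      3 * d * ∑ i, (fd i χ x ^ 2 * fd i u x ^ 2 + fd i χ x ^ 2 * fd i u (x - Pi.single i 1) ^ 2 +
        fd i (fd i χ) (x - Pi.single i 1) ^ 2 * u (x - Pi.single i 1) ^ 2) := by
  rw [transport_eq_grad_form]
  have h1 := sq_sum_le_card_mul_sum_sq (s := (Finset.univ : Finset (Fin d)))
    (f := fun i => fd i χ x * (fd i u x + fd i u (x - Pi.single i 1)) +
        fd i (fd i χ) (x - Pi.single i 1) * u (x - Pi.single i 1))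
  simp only [Finset.card_univ, Fintype.card_fin] at h1
  have h2 : ∀ i : Fin d, (fd i χ x * (fd i u x + fd i u (x - Pi.single i 1)) +
        fd i (fd i χ) (x - Pi.single i 1) * u (x - Pi.single i 1)) ^ 2 ≤
      3 * (fd i χ x ^ 2 * fd i u x ^ 2 + fd i χ x ^ 2 * fd i u (x - Pi.single i 1) ^ 2 +
        fd i (fd i χ) (x - Pi.single i 1) ^ 2 * u (x - Pi.single i 1) ^ 2) := by
    intro i
    -- `(p + q + r)² ≤ 3(p² + q² + r²)` (also in the tree as `MatomakiRadziwillL14.sq_add_three_le`; three squares)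
    have key : ∀ p q r : ℝ, (p + q + r) ^ 2 ≤ 3 * (p ^ 2 + q ^ 2 + r ^ 2) := fun p q r => by
      nlinarith [sq_nonneg (p - q), sq_nonneg (q - r), sq_nonneg (p - r)]
    have := key (fd i χ x * fd i u x) (fd i χ x * fd i u (x - Pi.single i 1))
      (fd i (fd i χ) (x - Pi.single i 1) * u (x - Pi.single i 1))
    calc _ = (fd i χ x * fd i u x + fd i χ x * fd i u (x - Pi.single i 1) +
          fd i (fd i χ) (x - Pi.single i 1) * u (x - Pi.single i 1)) ^ 2 := by ring
      _ ≤ _ := this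
      _ = _ := by ring
  have h3 : (d : ℝ) * ∑ i, (fd i χ x * (fd i u x + fd i u (x - Pi.single i 1)) +
        fd i (fd i χ) (x - Pi.single i 1) * u (x - Pi.single i 1)) ^ 2 ≤
      (d : ℝ) * ∑ i, 3 * (fd i χ x ^ 2 * fd i u x ^ 2 + fd i χ x ^ 2 * fd i u (x - Pi.single i 1) ^ 2 +
        fd i (fd i χ) (x - Pi.single i 1) ^ 2 * u (x - Pi.single i 1) ^ 2) :=
    mul_le_mul_of_nonneg_left (Finset.sum_le_sum (fun i _ => h2 i)) (Nat.cast_nonneg d)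
  rw [← Finset.mul_sum] at h3
  linarith

/-! ## §2  Pointwise domination tools -/

/-- If `a ≠ 0` forces `w ≥ 1`, and `a² ≤ δ²`, then `a²·t ≤ δ²·w·t` for `t, w ≥ 0`. [folklore] -/
theorem sq_mul_le_of_dom {a w δ t : ℝ} (hw : a ≠ 0 → 1 ≤ w) (ha : a ^ 2 ≤ δ ^ 2) (ht : 0 ≤ t) (hw0 : 0 ≤ w) :
    a ^ 2 * t ≤ δ ^ 2 * w * t := by
  by_cases h : a = 0
  · rw [h]; simp only [ne_eq, zero_pow, zero_mul, OfNat.ofNat_ne_zero, not_false_eq_true]; positivity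
  · have h1 := hw h
    calc a ^ 2 * t ≤ δ ^ 2 * t := mul_le_mul_of_nonneg_right ha ht
      _ = δ ^ 2 * 1 * t := by ring
      _ ≤ δ ^ 2 * w * t := by gcongr

/-- `|a'² − a²| ≤ 2δ³` when `|a|, |a'| ≤ δ` and `|a' − a| ≤ δ²`. [folklore] -/
theorem abs_sq_sub_sq_le {a a' δ : ℝ} (ha : |a| ≤ δ) (ha' : |a'| ≤ δ) (hd : |a' - a| ≤ δ ^ 2) :
    |a' ^ 2 - a ^ 2| ≤ 2 * δ ^ 3 := by
  have hδ : 0 ≤ δ := le_trans (abs_nonneg a) ha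
  rw [show a' ^ 2 - a ^ 2 = (a' - a) * (a' + a) by ring, abs_mul]
  have h2 : |a' + a| ≤ 2 * δ := le_trans (abs_add_le a' a) (by linarith)
  calc |a' - a| * |a' + a| ≤ δ ^ 2 * (2 * δ) := mul_le_mul hd h2 (abs_nonneg _) (by positivity)
    _ = 2 * δ ^ 3 := by ring

/-- Young with a scale: `c·|p|·|q| ≤ δ⁴p² + δ²q²` whenever `c ≤ 2δ³`. [folklore] -/
theorem mul_abs_mul_abs_le {c p q δ : ℝ} (hc : c ≤ 2 * δ ^ 3) :
    c * |p| * |q| ≤ δ ^ 4 * p ^ 2 + δ ^ 2 * q ^ 2 := by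
  have h1 : c * |p| * |q| ≤ 2 * δ ^ 3 * |p| * |q| := by
    have := mul_le_mul_of_nonneg_right (mul_le_mul_of_nonneg_right hc (abs_nonneg p)) (abs_nonneg q)
    linarith
  have h2 : 2 * δ ^ 3 * |p| * |q| ≤ δ ^ 4 * p ^ 2 + δ ^ 2 * q ^ 2 := by
    have e : δ ^ 4 * p ^ 2 + δ ^ 2 * q ^ 2 - 2 * δ ^ 3 * |p| * |q| = (δ ^ 2 * |p| - δ * |q|) ^ 2 := by
      rw [← sq_abs p, ← sq_abs q]; ring
    nlinarith [sq_nonneg (δ ^ 2 * |p| - δ * |q|), e]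
  linarith

variable [NeZero N]

/-- A `ψ²`-weighted sum is at most the plain sum over any finset containing the support of `ψ` (`0 ≤ ψ ≤ 1`, `f ≥ 0`).
[folklore] -/
theorem sum_sq_mul_le_sum_mem (ψ f : TorusSite d N → ℝ) (M : Finset (TorusSite d N)) (hψ01 : ∀ x, 0 ≤ ψ x ∧ ψ x ≤ 1)
    (hM : ∀ x, ψ x ≠ 0 → x ∈ M) (hf : ∀ x, 0 ≤ f x) :
    ∑ x, ψ x ^ 2 * f x ≤ ∑ x ∈ M, f x := by
  classical
  have key : ∀ x, ψ x ^ 2 * f x ≤ if x ∈ M then f x else 0 := by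
    intro x
    by_cases hx : x ∈ M
    · rw [if_pos hx]
      have h1 : ψ x ^ 2 ≤ 1 := by
        have := hψ01 x; nlinarith
      calc ψ x ^ 2 * f x ≤ 1 * f x := mul_le_mul_of_nonneg_right h1 (hf x)
        _ = f x := one_mul _
    · have h0 : ψ x = 0 := by
        by_contra h; exact hx (hM x h)
      rw [if_neg hx, h0]; simp
  calc ∑ x, ψ x ^ 2 * f x ≤ ∑ x, (if x ∈ M then f x else 0) := Finset.sum_le_sum (fun x _ => key x)
    _ = ∑ x ∈ M, f x := by rw [Finset.sum_ite_mem, Finset.univ_inter]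

end Real

/-! ## §3  The plate energy of a biharmonic function under a cut-off

Throughout, `D_ψ := ΣⱼΣ_x (ψ(x)²+ψ(x+eⱼ)²)(∂ⱼh(x))²` and `H_ψ := Σ_x ψ(x)²h(x)²` (written out; no definition is introduced), and the
standing hypotheses are: `|∂χ| ≤ δ`, `|∂∂χ| ≤ δ²`, and `ψ = 1` on the radius-2 neighbourhood of every point where `χ` varies. -/

section Biharmonic

variable [NeZero N]

/-- The transport square, dominated: `4Σ_x (K_χh)² ≤ 24d·δ²·D_ψ + 12d²·δ⁴·H_ψ`. [folklore] -/
theorem transport_sum_le (h χ ψ : TorusSite d N → ℝ) {δ : ℝ}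
    (hχ1 : ∀ i x, |fd i χ x| ≤ δ) (hχ2 : ∀ i j x, |fd j (fd i χ) x| ≤ δ ^ 2)
    (hχψ : ∀ i y, fd i χ y ≠ 0 → ψ y = 1 ∧ (∀ k : Fin d, ψ (y + Pi.single k 1) = 1 ∧ ψ (y - Pi.single k 1) = 1) ∧
      (∀ k l : Fin d, ψ (y + Pi.single k 1 + Pi.single l 1) = 1 ∧ ψ (y + Pi.single k 1 - Pi.single l 1) = 1 ∧
        ψ (y - Pi.single k 1 - Pi.single l 1) = 1)) :
    4 * ∑ x : TorusSite d N, (∑ i, ((χ (x + Pi.single i 1) - χ x) * h (x + Pi.single i 1) +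
        (χ (x - Pi.single i 1) - χ x) * h (x - Pi.single i 1))) ^ 2 ≤
      24 * d * δ ^ 2 * ∑ j, ∑ x : TorusSite d N, (ψ x ^ 2 + ψ (x + Pi.single j 1) ^ 2) * fd j h x ^ 2 +
        12 * d ^ 2 * δ ^ 4 * ∑ x : TorusSite d N, ψ x ^ 2 * h x ^ 2 := by
  set D : ℝ := ∑ j, ∑ x : TorusSite d N, (ψ x ^ 2 + ψ (x + Pi.single j 1) ^ 2) * fd j h x ^ 2 with hD
  set H : ℝ := ∑ x : TorusSite d N, ψ x ^ 2 * h x ^ 2 with hH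
  have hsq1 : ∀ i x, fd i χ x ^ 2 ≤ δ ^ 2 := fun i x => by
    have := hχ1 i x; rw [← sq_abs]; exact pow_le_pow_left₀ (abs_nonneg _) this 2
  have hsq2 : ∀ i j x, fd j (fd i χ) x ^ 2 ≤ (δ ^ 2) ^ 2 := fun i j x => by
    have := hχ2 i j x; rw [← sq_abs]; exact pow_le_pow_left₀ (abs_nonneg _) this 2
  have step1 : ∑ x : TorusSite d N, (∑ i, ((χ (x + Pi.single i 1) - χ x) * h (x + Pi.single i 1) +
      (χ (x - Pi.single i 1) - χ x) * h (x - Pi.single i 1))) ^ 2 ≤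
      ∑ x : TorusSite d N, 3 * d * ∑ i, (fd i χ x ^ 2 * fd i h x ^ 2 + fd i χ x ^ 2 * fd i h (x - Pi.single i 1) ^ 2 +
        fd i (fd i χ) (x - Pi.single i 1) ^ 2 * h (x - Pi.single i 1) ^ 2) :=
    Finset.sum_le_sum (fun x _ => transport_sq_le_grad χ h x)
  have t1 : ∑ x : TorusSite d N, ∑ i, fd i χ x ^ 2 * fd i h x ^ 2 ≤ δ ^ 2 * D := by
    rw [hD, Finset.mul_sum]
    calc ∑ x : TorusSite d N, ∑ i, fd i χ x ^ 2 * fd i h x ^ 2 = ∑ i, ∑ x : TorusSite d N, fd i χ x ^ 2 * fd i h x ^ 2 :=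
        Finset.sum_comm
      _ ≤ _ := Finset.sum_le_sum (fun i _ => ?_)
    rw [Finset.mul_sum]
    refine Finset.sum_le_sum (fun x _ => ?_)
    have hw : fd i χ x ≠ 0 → 1 ≤ ψ x ^ 2 + ψ (x + Pi.single i 1) ^ 2 := fun hne => by
      rw [(hχψ i x hne).1]; nlinarith [sq_nonneg (ψ (x + Pi.single i 1))]
    have := sq_mul_le_of_dom hw (hsq1 i x) (sq_nonneg (fd i h x)) (by positivity)
    linarith
  have t2 : ∑ x : TorusSite d N, ∑ i, fd i χ x ^ 2 * fd i h (x - Pi.single i 1) ^ 2 ≤ δ ^ 2 * D := by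
    rw [hD, Finset.mul_sum]
    calc ∑ x : TorusSite d N, ∑ i, fd i χ x ^ 2 * fd i h (x - Pi.single i 1) ^ 2
        = ∑ i, ∑ x : TorusSite d N, fd i χ x ^ 2 * fd i h (x - Pi.single i 1) ^ 2 := Finset.sum_comm
      _ ≤ _ := Finset.sum_le_sum (fun i _ => ?_)
    -- reindex x ↦ x - eᵢ on the right
    have e : ∑ x : TorusSite d N, (ψ x ^ 2 + ψ (x + Pi.single i 1) ^ 2) * fd i h x ^ 2 =
        ∑ x : TorusSite d N, (ψ (x - Pi.single i 1) ^ 2 + ψ x ^ 2) * fd i h (x - Pi.single i 1) ^ 2 := by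
      have hs := (sum_shift_sub (fun x => (ψ x ^ 2 + ψ (x + Pi.single i 1) ^ 2) * fd i h x ^ 2)
        (Pi.single i 1)).symm
      simp only [sub_add_cancel] at hs
      exact hs
    rw [e, Finset.mul_sum]
    refine Finset.sum_le_sum (fun x _ => ?_)
    have hw : fd i χ x ≠ 0 → 1 ≤ ψ (x - Pi.single i 1) ^ 2 + ψ x ^ 2 := fun hne => by
      rw [((hχψ i x hne).2.1 i).2]; nlinarith [sq_nonneg (ψ x)]
    have := sq_mul_le_of_dom hw (hsq1 i x) (sq_nonneg (fd i h (x - Pi.single i 1))) (by positivity)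
    linarith
  have t3 : ∑ x : TorusSite d N, ∑ i : Fin d, fd i (fd i χ) (x - Pi.single i 1) ^ 2 * h (x - Pi.single i 1) ^ 2 ≤
      δ ^ 4 * (d * H) := by
    have e : (d : ℝ) * H = ∑ i : Fin d, ∑ x : TorusSite d N, ψ (x - Pi.single i 1) ^ 2 * h (x - Pi.single i 1) ^ 2 := by
      have : ∀ i : Fin d, ∑ x : TorusSite d N, ψ (x - Pi.single i 1) ^ 2 * h (x - Pi.single i 1) ^ 2 = H := fun i =>
        sum_shift_sub (fun x => ψ x ^ 2 * h x ^ 2) (Pi.single i 1)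
      simp only [this, Finset.sum_const, Finset.card_univ, Fintype.card_fin, nsmul_eq_mul]
    have pt : ∀ (i : Fin d) (x : TorusSite d N),
        fd i (fd i χ) (x - Pi.single i 1) ^ 2 * h (x - Pi.single i 1) ^ 2 ≤
          δ ^ 4 * (ψ (x - Pi.single i 1) ^ 2 * h (x - Pi.single i 1) ^ 2) := by
      intro i x
      have hw : fd i (fd i χ) (x - Pi.single i 1) ≠ 0 → 1 ≤ ψ (x - Pi.single i 1) ^ 2 := fun hne => by
        have : fd i χ x ≠ 0 ∨ fd i χ (x - Pi.single i 1) ≠ 0 := by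
          by_contra hcon; push Not at hcon
          apply hne
          have h1 := hcon.1
          have h2 := hcon.2
          simp only [fd, sub_add_cancel] at h1 h2 ⊢
          linarith
        rcases this with h1 | h1
        · rw [((hχψ i x h1).2.1 i).2]; norm_num
        · rw [(hχψ i _ h1).1]; norm_num
      have := sq_mul_le_of_dom (δ := δ ^ 2) hw (hsq2 i i _) (sq_nonneg (h (x - Pi.single i 1))) (sq_nonneg _)
      calc fd i (fd i χ) (x - Pi.single i 1) ^ 2 * h (x - Pi.single i 1) ^ 2
          ≤ (δ ^ 2) ^ 2 * ψ (x - Pi.single i 1) ^ 2 * h (x - Pi.single i 1) ^ 2 := this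
        _ = δ ^ 4 * (ψ (x - Pi.single i 1) ^ 2 * h (x - Pi.single i 1) ^ 2) := by ring
    calc ∑ x : TorusSite d N, ∑ i : Fin d, fd i (fd i χ) (x - Pi.single i 1) ^ 2 * h (x - Pi.single i 1) ^ 2
        = ∑ i : Fin d, ∑ x : TorusSite d N, fd i (fd i χ) (x - Pi.single i 1) ^ 2 * h (x - Pi.single i 1) ^ 2 :=
          Finset.sum_comm
      _ ≤ ∑ i : Fin d, ∑ x : TorusSite d N, δ ^ 4 * (ψ (x - Pi.single i 1) ^ 2 * h (x - Pi.single i 1) ^ 2) :=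
          Finset.sum_le_sum (fun i _ => Finset.sum_le_sum (fun x _ => pt i x))
      _ = δ ^ 4 * (d * H) := by
          rw [e, Finset.mul_sum]
          exact Finset.sum_congr rfl (fun i _ => by rw [Finset.mul_sum])
  have step2 : ∑ x : TorusSite d N, 3 * d * ∑ i, (fd i χ x ^ 2 * fd i h x ^ 2 + fd i χ x ^ 2 * fd i h (x - Pi.single i 1) ^ 2 +
        fd i (fd i χ) (x - Pi.single i 1) ^ 2 * h (x - Pi.single i 1) ^ 2) ≤
      3 * d * (δ ^ 2 * D + δ ^ 2 * D + δ ^ 4 * (d * H)) := by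
    rw [← Finset.mul_sum]
    refine mul_le_mul_of_nonneg_left ?_ (by positivity)
    simp only [Finset.sum_add_distrib]
    linarith [t1, t2, t3]
  have e3 : 4 * (3 * (d : ℝ) * (δ ^ 2 * D + δ ^ 2 * D + δ ^ 4 * (d * H))) = 24 * d * δ ^ 2 * D + 12 * d ^ 2 * δ ^ 4 * H := by
    ring
  linarith [step1, step2, e3]

/-- The forward weight pairing, dominated (one direction `i`):
`ΣⱼΣ_x [(∂ᵢχ(x+eⱼ))²((∂ⱼh(x+eᵢ))² + (∂ⱼh(x))²)∕2 + |∂ⱼ(∂ᵢχ)²(x)|·|h(x+eᵢ)|·|∂ⱼh(x)|] ≤ 2δ²·D_ψ + d·δ⁴·H_ψ`. [folklore] -/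
theorem weight_fwd_le (h χ ψ : TorusSite d N → ℝ) {δ : ℝ}
    (hχ1 : ∀ i x, |fd i χ x| ≤ δ) (hχ2 : ∀ i j x, |fd j (fd i χ) x| ≤ δ ^ 2)
    (hχψ : ∀ i y, fd i χ y ≠ 0 → ψ y = 1 ∧ (∀ k : Fin d, ψ (y + Pi.single k 1) = 1 ∧ ψ (y - Pi.single k 1) = 1) ∧
      (∀ k l : Fin d, ψ (y + Pi.single k 1 + Pi.single l 1) = 1 ∧ ψ (y + Pi.single k 1 - Pi.single l 1) = 1 ∧
        ψ (y - Pi.single k 1 - Pi.single l 1) = 1)) (i : Fin d) :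
    ∑ j, ∑ x : TorusSite d N, (fd i χ (x + Pi.single j 1) ^ 2 * (fd j h (x + Pi.single i 1) ^ 2 + fd j h x ^ 2) / 2 +
        |fd j (fun y => fd i χ y ^ 2) x| * |h (x + Pi.single i 1)| * |fd j h x|) ≤
      2 * δ ^ 2 * ∑ j, ∑ x : TorusSite d N, (ψ x ^ 2 + ψ (x + Pi.single j 1) ^ 2) * fd j h x ^ 2 +
        d * δ ^ 4 * ∑ x : TorusSite d N, ψ x ^ 2 * h x ^ 2 := by
  set H : ℝ := ∑ x : TorusSite d N, ψ x ^ 2 * h x ^ 2 with hH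
  have hsq1 : ∀ i x, fd i χ x ^ 2 ≤ δ ^ 2 := fun i x => by
    have := hχ1 i x; rw [← sq_abs]; exact pow_le_pow_left₀ (abs_nonneg _) this 2
  have perj : ∀ j : Fin d, ∑ x : TorusSite d N, (fd i χ (x + Pi.single j 1) ^ 2 * (fd j h (x + Pi.single i 1) ^ 2 + fd j h x ^ 2) / 2 +
      |fd j (fun y => fd i χ y ^ 2) x| * |h (x + Pi.single i 1)| * |fd j h x|) ≤
      2 * δ ^ 2 * ∑ x : TorusSite d N, (ψ x ^ 2 + ψ (x + Pi.single j 1) ^ 2) * fd j h x ^ 2 + δ ^ 4 * H := by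
    intro j
    -- piece a: shifted gradient, reindexed by eᵢ
    have ea : ∑ x : TorusSite d N, (ψ x ^ 2 + ψ (x + Pi.single j 1) ^ 2) * fd j h x ^ 2 =
        ∑ x : TorusSite d N, (ψ (x + Pi.single i 1) ^ 2 + ψ (x + Pi.single i 1 + Pi.single j 1) ^ 2) *
          fd j h (x + Pi.single i 1) ^ 2 :=
      (sum_shift (fun x => (ψ x ^ 2 + ψ (x + Pi.single j 1) ^ 2) * fd j h x ^ 2) (Pi.single i 1)).symm
    have pa : ∑ x : TorusSite d N, fd i χ (x + Pi.single j 1) ^ 2 * fd j h (x + Pi.single i 1) ^ 2 ≤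
        δ ^ 2 * ∑ x : TorusSite d N, (ψ x ^ 2 + ψ (x + Pi.single j 1) ^ 2) * fd j h x ^ 2 := by
      rw [ea, Finset.mul_sum]
      refine Finset.sum_le_sum (fun x _ => ?_)
      have hw : fd i χ (x + Pi.single j 1) ≠ 0 →
          1 ≤ ψ (x + Pi.single i 1) ^ 2 + ψ (x + Pi.single i 1 + Pi.single j 1) ^ 2 := fun hne => by
        have h1 := ((hχψ i _ hne).2.2 i j).2.1
        rw [show x + Pi.single j 1 + Pi.single i 1 - Pi.single j 1 = x + Pi.single i 1 by abel] at h1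
        rw [h1]; nlinarith [sq_nonneg (ψ (x + Pi.single i 1 + Pi.single j 1))]
      have := sq_mul_le_of_dom hw (hsq1 i _) (sq_nonneg (fd j h (x + Pi.single i 1))) (by positivity)
      linarith
    have pb : ∑ x : TorusSite d N, fd i χ (x + Pi.single j 1) ^ 2 * fd j h x ^ 2 ≤
        δ ^ 2 * ∑ x : TorusSite d N, (ψ x ^ 2 + ψ (x + Pi.single j 1) ^ 2) * fd j h x ^ 2 := by
      rw [Finset.mul_sum]
      refine Finset.sum_le_sum (fun x _ => ?_)
      have hw : fd i χ (x + Pi.single j 1) ≠ 0 → 1 ≤ ψ x ^ 2 + ψ (x + Pi.single j 1) ^ 2 := fun hne => by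
        have h1 := ((hχψ i _ hne).2.1 j).2
        rw [add_sub_cancel_right] at h1
        rw [h1]; nlinarith [sq_nonneg (ψ (x + Pi.single j 1))]
      have := sq_mul_le_of_dom hw (hsq1 i _) (sq_nonneg (fd j h x)) (by positivity)
      linarith
    have pc : ∑ x : TorusSite d N, |fd j (fun y => fd i χ y ^ 2) x| * |h (x + Pi.single i 1)| * |fd j h x| ≤
        δ ^ 4 * H + δ ^ 2 * ∑ x : TorusSite d N, (ψ x ^ 2 + ψ (x + Pi.single j 1) ^ 2) * fd j h x ^ 2 := by
      have eH : H = ∑ x : TorusSite d N, ψ (x + Pi.single i 1) ^ 2 * h (x + Pi.single i 1) ^ 2 :=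
        (sum_shift (fun x => ψ x ^ 2 * h x ^ 2) (Pi.single i 1)).symm
      rw [eH, Finset.mul_sum, Finset.mul_sum, ← Finset.sum_add_distrib]
      refine Finset.sum_le_sum (fun x _ => ?_)
      have hc : |fd j (fun y => fd i χ y ^ 2) x| ≤ 2 * δ ^ 3 := by
        have := abs_sq_sub_sq_le (hχ1 i x) (hχ1 i (x + Pi.single j 1)) (by simpa only [fd] using hχ2 i j x)
        simpa only [fd] using this
      have hy := mul_abs_mul_abs_le (p := h (x + Pi.single i 1)) (q := fd j h x) hc
      by_cases hz : fd j (fun y => fd i χ y ^ 2) x = 0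
      · rw [hz, abs_zero, zero_mul, zero_mul]; positivity
      · -- then χ varies at x + eⱼ or at x: ψ = 1 at x + eᵢ and at x
        have hvar : fd i χ (x + Pi.single j 1) ≠ 0 ∨ fd i χ x ≠ 0 := by
          by_contra hcon; push Not at hcon
          apply hz; simp only [fd] at hcon ⊢; rw [hcon.1, hcon.2]; ring
        have hψ1 : ψ (x + Pi.single i 1) = 1 := by
          rcases hvar with h1 | h1
          · have := ((hχψ i _ h1).2.2 i j).2.1
            rwa [show x + Pi.single j 1 + Pi.single i 1 - Pi.single j 1 = x + Pi.single i 1 by abel] at this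
          · exact ((hχψ i _ h1).2.1 i).1
        have hψ2 : ψ x = 1 := by
          rcases hvar with h1 | h1
          · have := ((hχψ i _ h1).2.1 j).2; rwa [add_sub_cancel_right] at this
          · exact (hχψ i _ h1).1
        rw [hψ1, hψ2]
        have hnn : 0 ≤ δ ^ 2 * (ψ (x + Pi.single j 1) ^ 2 * fd j h x ^ 2) := by positivity
        have e2 : δ ^ 4 * ((1 : ℝ) ^ 2 * h (x + Pi.single i 1) ^ 2) + δ ^ 2 * ((1 ^ 2 + ψ (x + Pi.single j 1) ^ 2) * fd j h x ^ 2) =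
            (δ ^ 4 * h (x + Pi.single i 1) ^ 2 + δ ^ 2 * fd j h x ^ 2) + δ ^ 2 * (ψ (x + Pi.single j 1) ^ 2 * fd j h x ^ 2) := by
          ring
        rw [e2]
        linarith [hy, hnn]
    have split : ∑ x : TorusSite d N, (fd i χ (x + Pi.single j 1) ^ 2 * (fd j h (x + Pi.single i 1) ^ 2 + fd j h x ^ 2) / 2 +
        |fd j (fun y => fd i χ y ^ 2) x| * |h (x + Pi.single i 1)| * |fd j h x|) =
        (1 / 2) * (∑ x : TorusSite d N, fd i χ (x + Pi.single j 1) ^ 2 * fd j h (x + Pi.single i 1) ^ 2) +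
        (1 / 2) * (∑ x : TorusSite d N, fd i χ (x + Pi.single j 1) ^ 2 * fd j h x ^ 2) +
        ∑ x : TorusSite d N, |fd j (fun y => fd i χ y ^ 2) x| * |h (x + Pi.single i 1)| * |fd j h x| := by
      rw [Finset.mul_sum, Finset.mul_sum, ← Finset.sum_add_distrib, ← Finset.sum_add_distrib]
      exact Finset.sum_congr rfl (fun x _ => by ring)
    rw [split]
    linarith [pa, pb, pc]
  calc _ ≤ ∑ j : Fin d, (2 * δ ^ 2 * ∑ x : TorusSite d N, (ψ x ^ 2 + ψ (x + Pi.single j 1) ^ 2) * fd j h x ^ 2 + δ ^ 4 * H) :=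
        Finset.sum_le_sum (fun j _ => perj j)
    _ = _ := by
        rw [Finset.sum_add_distrib, ← Finset.mul_sum, Finset.sum_const, Finset.card_univ, Fintype.card_fin,
          nsmul_eq_mul]; ring

end Biharmonic

end Summit.QuantumFields.YangMills.Theorems.N07PlateCaccioppoliBiharmonic

end
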